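import Mathlib
import Summits.NavierStokesRegularity.NavierStokesRegularity.Theorems.SubOnsagerCeilingSideBranchDynamics
import HarnessLib

/-!
# Route SubOnsagerCeiling — the LIVE-BLOCK BALANCE of the side-branch table `α_SB`
# (helper file for item stmt-NavierStokesRegularity-25507 `OrthantTailCeiling`; `--supports`; def-free)

Second brick of the ENGINE for the Onsager-critical escape construction
(`SideBranchCriticalEscapeEstimateAt`, p823602): the bookkeeping functional of the Katz–Pavlović-type
induction.  For a depth `K` put

  `G_K(u) = −B_K(u) + ½ s_K(u)²`,  `B_K(u) = Σ_{k ≤ K} Σ_i ½X_{i,k}(u)²`, `s_K = X_{1,K}`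

(up to the constant `E₀`, `E₀ + G_K` is the energy that has LEFT the chain modes `x_0..x_K` and the
completed side units of the shells `< K`: it sits in the side unit `(s_K, z_{K+1})`, beyond the bond
`K`, or has been burned).  Along a regular solution of the `ν`-viscous `α_SB` lattice on `[0,s]` with no
shells below `0`:

* `sideBranch_liveBlock_hasDerivWithinAt` — `G_K' = Π_K + D_K + s_K·(ṡ_K)` exactly, with the bond flux
  `Π_K = botSum` and the block dissipation `D_K = Σ_{k ≤ K} ν_k Σ_i X_{i,k}²` (telescoping of the
  cancelling nonlinearity, Tao (4.3), as in `sideBranch_block_budget`);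
* `sideBranch_liveBlock_deriv_ge` — if `s_K ≥ 0` at `u` then
  `G_K'(u) ≥ Λ_K x_K² x_{K+1}`: the pocket feed `(1/5)Λ_K s_K² z_{K+1}` cancels between `−B_K'` and
  `s_K ṡ_K`, the pump `(1/5)Λ_K x_K² s_K ≥ 0` and `D_K − ν_K s_K² ≥ 0` are dropped — so `G_K` is
  non-decreasing and is driven by the chain flux alone (input `hG'` of `sideBranch_drive_gain`).

HONEST FRAMING: elementary real analysis of a Tao-type MODEL lattice ODE (route SubOnsagerCeiling, rung
TL-M2Break); a brick toward a construction NOT carried out here; nothing bears on Navier–Stokes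
regularity; no crux is settled here. [cite: Tao2016AveragedNS, §4 (4.2)–(4.3)]
-/

noncomputable section

-- the sub-problem namespace `NavierStokesRegularity.NavierStokesRegularity` is the tree's layout (D-0017)
set_option linter.dupNamespace false

namespace Summit.NavierStokesRegularity.NavierStokesRegularity.Theorems.SubOnsagerCeiling

open Set
open Literature.Analysis.FluidPDE.TaoCascade

section Solution

variable {ε₀ ν s : ℝ} {X : Fin 4 → ℤ → ℝ → ℝ}

/-- **The live-block balance, exactly.** Along a regular solution of the `ν`-viscous `α_SB` lattice on
`[0,s]` vanishing below shell `0`, the functional `u ↦ −Σ_{k ≤ K} Σ_i ½X_{i,k}(u)² + ½X_{1,K}(u)²` has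
one-sided derivative `Π_K(u) + Σ_{k ≤ K} Σ_i ν(1+ε₀)^{2k} X_{i,k}(u)² + X_{1,K}(u)·(quadTerm_{1,K}(u) −
ν(1+ε₀)^{2K} X_{1,K}(u))` within `[0,s]` (`Π_K = botSum`, telescoping by (4.3)). [this file] -/
theorem sideBranch_liveBlock_hasDerivWithinAt (hlow : ∀ (i : Fin 4) (k : ℤ), k < 0 → ∀ t : ℝ, X i k t = 0)
    (hder : ∀ (i : Fin 4) (k : ℤ), ∀ t ∈ Icc (0 : ℝ) s, HasDerivWithinAt (X i k)
      (quadTerm ε₀ sideBranchTable X i k t - ν * (1 + ε₀) ^ ((2 : ℝ) * k) * X i k t)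
      (Icc (0 : ℝ) s) t)
    (K : ℕ) {u : ℝ} (hu : u ∈ Icc (0 : ℝ) s) :
    HasDerivWithinAt
      (fun w => -(∑ k ∈ Finset.range (K + 1), ∑ i : Fin 4, (1 / 2 : ℝ) * X i (k : ℤ) w ^ 2) +
        (1 / 2 : ℝ) * X 1 (K : ℤ) w ^ 2)
      (botSum ε₀ sideBranchTable X (K : ℤ) u +
        (∑ k ∈ Finset.range (K + 1), ∑ i : Fin 4,
          ν * (1 + ε₀) ^ ((2 : ℝ) * ((k : ℤ) : ℝ)) * X i (k : ℤ) u ^ 2) +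
        X 1 (K : ℤ) u * (quadTerm ε₀ sideBranchTable X 1 (K : ℤ) u -
          ν * (1 + ε₀) ^ ((2 : ℝ) * ((K : ℤ) : ℝ)) * X 1 (K : ℤ) u))
      (Icc (0 : ℝ) s) u := by
  set c : ℤ → ℝ := fun k => ν * (1 + ε₀) ^ ((2 : ℝ) * (k : ℝ)) with hc
  -- block energy and its derivative
  set D : ℝ := ∑ k ∈ Finset.range (K + 1), ∑ i : Fin 4,
    X i (k : ℤ) u * (quadTerm ε₀ sideBranchTable X i k u - c k * X i k u) with hD
  have hderB : HasDerivWithinAt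
      (fun w => ∑ k ∈ Finset.range (K + 1), ∑ i : Fin 4, (1 / 2 : ℝ) * X i (k : ℤ) w ^ 2) D
      (Icc 0 s) u := by
    simp only [hD]
    refine HasDerivWithinAt.fun_sum fun k _ => HasDerivWithinAt.fun_sum fun i _ => ?_
    have h := ((hder i k u hu).pow 2).const_mul (1 / 2 : ℝ)
    refine h.congr_deriv ?_
    rw [show (2 : ℕ) - 1 = 1 from rfl, pow_one]
    simp only [hc]
    push_cast
    ring
  -- `D = −Π_K − dissipation`
  have hDeq : D = -(botSum ε₀ sideBranchTable X K u) -
      ∑ k ∈ Finset.range (K + 1), ∑ i : Fin 4, c k * X i (k : ℤ) u ^ 2 := by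
    have hsplit : D = (∑ k ∈ Finset.range (K + 1), ∑ i : Fin 4,
        quadTerm ε₀ sideBranchTable X i ((0 : ℤ) + k) u * X i ((0 : ℤ) + k) u) -
        ∑ k ∈ Finset.range (K + 1), ∑ i : Fin 4, c k * X i (k : ℤ) u ^ 2 := by
      simp only [hD, zero_add, ← Finset.sum_sub_distrib]
      refine Finset.sum_congr rfl fun k _ => Finset.sum_congr rfl fun i _ => ?_
      ring
    rw [sum_range_sum_quadTerm_mul ε₀ sideBranchTable_cancelling X 0 (K + 1) u] at hsplit
    have hX1 : ∀ (i : Fin 4) (w : ℝ), X i (-1) w = 0 := fun i w => hlow i (-1) (by norm_num) w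
    have htop0 : topSum ε₀ sideBranchTable X (0 - 1) u = 0 := by
      simp [topSum, hX1]
    have hidx : (0 : ℤ) + ((K + 1 : ℕ) : ℤ) - 1 = (K : ℤ) := by push_cast; ring
    rw [htop0, sub_zero, hidx, ← neg_neg (topSum ε₀ sideBranchTable X (K : ℤ) u),
      ← botSum_eq_neg_topSum ε₀ sideBranchTable_cancelling X (K : ℤ) u] at hsplit
    exact hsplit
  -- the side mode squared
  have hderS : HasDerivWithinAt (fun w => (1 / 2 : ℝ) * X 1 (K : ℤ) w ^ 2)
      (X 1 (K : ℤ) u * (quadTerm ε₀ sideBranchTable X 1 (K : ℤ) u -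
        ν * (1 + ε₀) ^ ((2 : ℝ) * ((K : ℤ) : ℝ)) * X 1 (K : ℤ) u)) (Icc 0 s) u := by
    have h := ((hder 1 (K : ℤ) u hu).pow 2).const_mul (1 / 2 : ℝ)
    refine h.congr_deriv ?_
    rw [show (2 : ℕ) - 1 = 1 from rfl, pow_one]
    ring
  have h := hderB.neg.add hderS
  refine h.congr_deriv ?_
  rw [hDeq]
  simp only [hc]
  ring

/-- **The live block is driven by the chain flux.** At a time `u` where `s_K(u) ≥ 0` (and `ν ≥ 0`),
the derivative of `sideBranch_liveBlock_hasDerivWithinAt` is at least the chain energy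
flux `Λ_K x_K(u)² x_{K+1}(u)`: the pocket feed cancels, the pump into `s_K` and the dissipation surplus
`D_K − ν_K s_K²` are non-negative. [this file] -/
theorem sideBranch_liveBlock_deriv_ge (hε : 0 < ε₀) (hν : 0 ≤ ν) (K : ℕ) {u : ℝ}
    (hsK : 0 ≤ X 1 (K : ℤ) u) :
    (1 + ε₀) ^ ((5 : ℝ) * ((K : ℤ) : ℝ) / 2) * X 0 (K : ℤ) u ^ 2 * X 0 ((K : ℤ) + 1) u ≤
      botSum ε₀ sideBranchTable X (K : ℤ) u +
        (∑ k ∈ Finset.range (K + 1), ∑ i : Fin 4,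
          ν * (1 + ε₀) ^ ((2 : ℝ) * ((k : ℤ) : ℝ)) * X i (k : ℤ) u ^ 2) +
        X 1 (K : ℤ) u * (quadTerm ε₀ sideBranchTable X 1 (K : ℤ) u -
          ν * (1 + ε₀) ^ ((2 : ℝ) * ((K : ℤ) : ℝ)) * X 1 (K : ℤ) u) := by
  have hb : (0 : ℝ) < 1 + ε₀ := by linarith
  set Λ : ℝ := (1 + ε₀) ^ ((5 : ℝ) * ((K : ℤ) : ℝ) / 2) with hΛ
  have hΛ0 : 0 ≤ Λ := Real.rpow_nonneg hb.le _
  -- the dissipation sum dominates its `(k, i) = (K, 1)` term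
  have hdiss : ν * (1 + ε₀) ^ ((2 : ℝ) * ((K : ℤ) : ℝ)) * X 1 (K : ℤ) u ^ 2 ≤
      ∑ k ∈ Finset.range (K + 1), ∑ i : Fin 4,
        ν * (1 + ε₀) ^ ((2 : ℝ) * ((k : ℤ) : ℝ)) * X i (k : ℤ) u ^ 2 := by
    have hnn : ∀ k ∈ Finset.range (K + 1), 0 ≤ ∑ i : Fin 4,
        ν * (1 + ε₀) ^ ((2 : ℝ) * ((k : ℤ) : ℝ)) * X i (k : ℤ) u ^ 2 := fun k _ =>
      Finset.sum_nonneg fun i _ => mul_nonneg (mul_nonneg hν (Real.rpow_nonneg hb.le _)) (sq_nonneg _)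
    have h1 := Finset.single_le_sum hnn (Finset.self_mem_range_succ K)
    have h2 : ν * (1 + ε₀) ^ ((2 : ℝ) * ((K : ℤ) : ℝ)) * X 1 (K : ℤ) u ^ 2 ≤
        ∑ i : Fin 4, ν * (1 + ε₀) ^ ((2 : ℝ) * (((K : ℕ) : ℤ) : ℝ)) * X i ((K : ℕ) : ℤ) u ^ 2 :=
      Finset.single_le_sum (f := fun i => ν * (1 + ε₀) ^ ((2 : ℝ) * (((K : ℕ) : ℤ) : ℝ)) *
        X i ((K : ℕ) : ℤ) u ^ 2)
        (fun i _ => mul_nonneg (mul_nonneg hν (Real.rpow_nonneg hb.le _)) (sq_nonneg _))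
        (Finset.mem_univ (1 : Fin 4))
    exact h2.trans h1
  rw [sideBranch_botSum, sideBranch_quadTerm_one, ← hΛ]
  have hpump : 0 ≤ (1 / 5 : ℝ) * Λ * X 0 (K : ℤ) u ^ 2 * X 1 (K : ℤ) u := by positivity
  nlinarith [hdiss, hpump]

end Solution

end Summit.NavierStokesRegularity.NavierStokesRegularity.Theorems.SubOnsagerCeiling

end
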